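import Literature.Probability.Percolation.DecisionTreeTwoConfigHK
import Summits.CriticalPhenomena.PercolationContinuityZ3.Theorems.PercNearOneGluingNoHeavyLowerTailAPLGluedCells
import HarnessLib

/-!
# `NoHeavyLowerTail` (stmt-CriticalPhenomena-4575) — the graph ↔ cells dictionary, III: the cells of a pendant apex

Support file (prover prim-ineq-gen-8 gen 36; `--supports stmt-CriticalPhenomena-4575`; memo
run/shared/lean/prim/prim-ineq-gen-8/FINDING-gen36-LEMMA-U.md §4, step (D2)).  No definitions, no named facts, no sorries.

SETTING.  Weights `p : Sym2 V → ℝ`, an edge set `D : Finset (Sym2 V)` in which the apex `a` meets exactly one edge `s(a, g)` (`a ≠ g`), targets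
`b, c ≠ a`; cells of `(a; b, c)` on `D` and of `(g; b, c)` on `D' = D.erase s(a,g)` as `DecisionTree.PrW` of the cluster events
(`Gladkov.cl`), as in `…APLGluedCells.lean`.
* `pendant_not_mem_cl` — if no edge of `L` contains `a` then `cl L a = {a}`;
* `pendant_apex_iff` — with the pendant edge open, `t ∈ cl (insert s(a,g) L) a ↔ t ∈ cl L g` (`t ≠ a`);
* `pendant_bc_iff` — the pendant edge does not change `c ∈ cl · b` (`b, c ≠ a`): a walk through the degree-one vertex `a` is not needed;
* `pendant_cell_zero/ab/ac/bc/three` — **THE PENDANT LEMMA**: with `z = p s(a,g)` and `u` the cells of `(g; b, c)` on `D'`,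
  `P(a|b|c) = z·u0 + (1−z)·P_{D'}(b ↮ c)`, `P(ab|c) = z·uab`, `P(ac|b) = z·uac`, `P(a|bc) = z·ubc + (1−z)·P_{D'}(b ↔ c)`, `P(abc) = z·u3`
  (one-edge disintegration `DTree2.PrW_split`); with `P_{D'}(b ↮ c) = u0+uab+uac`, `P_{D'}(b ↔ c) = ubc+u3` (`pendant_split_bc`,
  `pendant_split_bc'`) this is the cell map `(u0+(1−z)(uab+uac), z·uab, z·uac, ubc+(1−z)u3, z·u3)` of `conjF_c_pendant` (`…APLConjF.lean`).
[folklore]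
-/

namespace Summit.CriticalPhenomena.PercolationContinuityZ3.Theorems

namespace APL

open Literature.Probability.Percolation Literature.Probability.Percolation.Gladkov Literature.Probability.Percolation.DecisionTree
open scoped Classical

variable {V : Type*} [Fintype V] [DecidableEq V]

omit [Fintype V] in
/-- In an edge set where `a` meets only `s(a,g)`, no edge of a subset of `D.erase s(a,g)` contains `a`. [folklore] -/
theorem pendant_isolated_of_subset (D : Finset (Sym2 V)) (a g : V) (hD : ∀ f ∈ D, a ∈ f → f = s(a, g))
    {L : Finset (Sym2 V)} (hL : L ⊆ D.erase s(a, g)) : ∀ f ∈ L, a ∉ f := fun f hf haf => by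
  have h := Finset.mem_erase.1 (hL hf)
  exact h.1 (hD f h.2 haf)

omit [DecidableEq V] in
/-- If no edge of `L` contains `a`, then no other vertex lies in the cluster of `a`. [folklore] -/
theorem pendant_not_mem_cl {L : Finset (Sym2 V)} {a : V} (hLa : ∀ f ∈ L, a ∉ f) {t : V} (ht : t ≠ a) : t ∉ cl L a := fun h => by
  obtain ⟨f, hf, haf⟩ := exists_mem_edge_of_mem_cl (mem_cl_comm.1 h) ht.symm
  exact hLa f hf haf

/-- With the pendant edge `s(a,g)` open (and no other edge at `a`), a vertex `t ≠ a` is joined to `a` iff it is joined to `g` without the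
pendant edge. [folklore] -/
theorem pendant_apex_iff {a g : V} (hag : a ≠ g) {L : Finset (Sym2 V)} (hLa : ∀ f ∈ L, a ∉ f) {t : V} (ht : t ≠ a) :
    t ∈ cl (insert s(a, g) L) a ↔ t ∈ cl L g := by
  constructor
  · intro h
    -- the set `insert a (cl L g)` contains `a` and is closed under adjacency in `insert s(a,g) L`
    have hclosed : ∀ u v, u ∈ insert a (cl L g) → (openGraph (↑(insert s(a, g) L) : Set (Sym2 V))).Adj u v →
        v ∈ insert a (cl L g) := by
      intro u v hu huv
      rw [adj_iff, Finset.mem_insert] at huv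
      obtain ⟨he | he, hne⟩ := huv
      · -- the pendant edge itself
        rcases Sym2.eq_iff.1 he with ⟨_, hv'⟩ | ⟨_, hv'⟩
        · rw [hv']; exact Finset.mem_insert_of_mem (mem_cl_self _ _)
        · rw [hv']; exact Finset.mem_insert_self _ _
      · rcases Finset.mem_insert.1 hu with rfl | hu
        · exact absurd (Sym2.mem_mk_left _ _) (hLa _ he)
        · exact Finset.mem_insert_of_mem (mem_cl_of_adj hu (adj_iff.2 ⟨he, hne⟩))
    rw [mem_cl] at h
    obtain ⟨w⟩ := h
    have := mem_of_walk hclosed w (Finset.mem_insert_self _ _)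
    rcases Finset.mem_insert.1 this with h' | h'
    · exact absurd h' ht
    · exact h'
  · intro h
    have hg : g ∈ cl (insert s(a, g) L) a :=
      mem_cl_of_adj (mem_cl_self _ _) (adj_iff.2 ⟨Finset.mem_insert_self _ _, hag⟩)
    exact ThreePointLB.mem_cl_trans hg (ThreePointLB.cl_mono (Finset.subset_insert _ _) _ h)

/-- The pendant edge at `a` does not change connections among vertices other than `a`: for `b, c ≠ a`,
`c ∈ cl (insert s(a,g) L) b ↔ c ∈ cl L b`. [folklore] -/
theorem pendant_bc_iff {a g : V} (hag : a ≠ g) {L : Finset (Sym2 V)} (hLa : ∀ f ∈ L, a ∉ f) {b c : V} (hb : b ≠ a) (hc : c ≠ a) :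
    c ∈ cl (insert s(a, g) L) b ↔ c ∈ cl L b := by
  constructor
  · intro h
    have hab : a ∉ cl L b := fun h' => pendant_not_mem_cl hLa hb (mem_cl_comm.1 h')
    -- closed set: `cl L b`, plus `a` when `g ∈ cl L b`
    have hclosed : ∀ u v, u ∈ cl L b ∪ (if g ∈ cl L b then ({a} : Finset V) else ∅) →
        (openGraph (↑(insert s(a, g) L) : Set (Sym2 V))).Adj u v → v ∈ cl L b ∪ (if g ∈ cl L b then ({a} : Finset V) else ∅) := by
      intro u v hu huv
      rw [adj_iff, Finset.mem_insert] at huv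
      obtain ⟨he | he, hne⟩ := huv
      · rcases Sym2.eq_iff.1 he with ⟨hu', hv'⟩ | ⟨hu', hv'⟩
        · -- u = a, v = g: then `a` was admitted because `g ∈ cl L b`
          rw [hv']
          rw [hu'] at hu
          rcases Finset.mem_union.1 hu with hu | hu
          · exact absurd hu hab
          · by_cases hg : g ∈ cl L b
            · exact Finset.mem_union_left _ hg
            · simp [hg] at hu
        · -- u = g, v = a
          rw [hv']
          rw [hu'] at hu
          rcases Finset.mem_union.1 hu with hu | hu
          · exact Finset.mem_union_right _ (by simp [hu])
          · by_cases hg : g ∈ cl L b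
            · exact Finset.mem_union_right _ (by simp [hg])
            · simp [hg] at hu
      · rcases Finset.mem_union.1 hu with hu | hu
        · exact Finset.mem_union_left _ (mem_cl_of_adj hu (adj_iff.2 ⟨he, hne⟩))
        · by_cases hg : g ∈ cl L b
          · simp only [hg, if_true, Finset.mem_singleton] at hu
            subst hu
            exact absurd (Sym2.mem_mk_left _ _) (hLa _ he)
          · simp [hg] at hu
    rw [mem_cl] at h
    obtain ⟨w⟩ := h
    have := mem_of_walk hclosed w (Finset.mem_union_left _ (mem_cl_self _ _))
    rcases Finset.mem_union.1 this with h' | h'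
    · exact h'
    · by_cases hg : g ∈ cl L b
      · simp only [hg, if_true, Finset.mem_singleton] at h'
        exact absurd h' hc
      · simp [hg] at h'
  · exact fun h => ThreePointLB.cl_mono (Finset.subset_insert _ _) _ h

omit [Fintype V] in
/-- A `PrW` over sets none of which lies in the event vanishes. [folklore] -/
theorem PrW_eq_zero_of_forall_not_mem (D : Finset (Sym2 V)) (p : Sym2 V → ℝ) {X : Set (Finset (Sym2 V))}
    (h : ∀ L, L ⊆ D → L ∈ X → False) : PrW D p X = 0 := by
  unfold PrW
  refine Finset.sum_eq_zero fun L hL => ?_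
  rw [Finset.mem_powerset] at hL
  exact Set.indicator_of_notMem (fun hx => h L hL hx) _

/-- **Pendant lemma, cell `a|b|c`.**  If the apex `a` meets exactly one edge `s(a,g)` of `D` (`a ≠ g`, `b, c ≠ a`), the `a|b|c`-cell of
`(a; b, c)` on `D` is obtained from the cells of `(g; b, c)` on `D.erase s(a,g)` by pendant scaling with `z = p s(a,g)`
(the cell map of `conjF_c_pendant`). [folklore] -/
theorem pendant_cell_zero (p : Sym2 V → ℝ) (D : Finset (Sym2 V)) (a g b c : V) (hag : a ≠ g) (hba : b ≠ a) (hca : c ≠ a)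
    (he : s(a, g) ∈ D) (hD : ∀ f ∈ D, a ∈ f → f = s(a, g)) :
    PrW D p {K : Finset (Sym2 V) | b ∉ cl K a ∧ c ∉ cl K a ∧ c ∉ cl K b}
      = p s(a, g) * PrW (D.erase s(a, g)) p {K : Finset (Sym2 V) | b ∉ cl K g ∧ c ∉ cl K g ∧ c ∉ cl K b} + (1 - p s(a, g)) * PrW (D.erase s(a, g)) p {K : Finset (Sym2 V) | c ∉ cl K b} := by
  have i1 : ∀ R : Finset (Sym2 V), DTree2.ins s(a, g) true R = insert s(a, g) R := fun R => by simp [DTree2.ins]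
  have i0 : ∀ R : Finset (Sym2 V), DTree2.ins s(a, g) false R = R := fun R => by simp [DTree2.ins]
  have hopen : PrW (D.erase s(a, g)) p {R : Finset (Sym2 V) | DTree2.ins s(a, g) true R ∈ {K : Finset (Sym2 V) | b ∉ cl K a ∧ c ∉ cl K a ∧ c ∉ cl K b}}
      = PrW (D.erase s(a, g)) p {K : Finset (Sym2 V) | b ∉ cl K g ∧ c ∉ cl K g ∧ c ∉ cl K b} := by
    refine PrW_congr_set _ p fun L hL => ?_
    have hLa := pendant_isolated_of_subset D a g hD hL
    simp only [Set.mem_setOf_eq, i1, pendant_apex_iff hag hLa hba, pendant_apex_iff hag hLa hca, pendant_bc_iff hag hLa hba hca]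
  have hclosed : PrW (D.erase s(a, g)) p {R : Finset (Sym2 V) | DTree2.ins s(a, g) false R ∈ {K : Finset (Sym2 V) | b ∉ cl K a ∧ c ∉ cl K a ∧ c ∉ cl K b}}
      = PrW (D.erase s(a, g)) p {K : Finset (Sym2 V) | c ∉ cl K b} := by
    refine PrW_congr_set _ p fun L hL => ?_
    have hLa := pendant_isolated_of_subset D a g hD hL
    simp only [Set.mem_setOf_eq, i0, pendant_not_mem_cl hLa hba, pendant_not_mem_cl hLa hca, not_false_eq_true, true_and]
  rw [DTree2.PrW_split D p he, Fintype.sum_bool]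
  simp only [DTree2.wt1, if_true, Bool.false_eq_true, if_false]
  rw [hopen, hclosed]

/-- **Pendant lemma, cell `ab|c`.**  If the apex `a` meets exactly one edge `s(a,g)` of `D` (`a ≠ g`, `b, c ≠ a`), the `ab|c`-cell of
`(a; b, c)` on `D` is obtained from the cells of `(g; b, c)` on `D.erase s(a,g)` by pendant scaling with `z = p s(a,g)`
(the cell map of `conjF_c_pendant`). [folklore] -/
theorem pendant_cell_ab (p : Sym2 V → ℝ) (D : Finset (Sym2 V)) (a g b c : V) (hag : a ≠ g) (hba : b ≠ a) (hca : c ≠ a)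
    (he : s(a, g) ∈ D) (hD : ∀ f ∈ D, a ∈ f → f = s(a, g)) :
    PrW D p {K : Finset (Sym2 V) | b ∈ cl K a ∧ c ∉ cl K a}
      = p s(a, g) * PrW (D.erase s(a, g)) p {K : Finset (Sym2 V) | b ∈ cl K g ∧ c ∉ cl K g} := by
  have i1 : ∀ R : Finset (Sym2 V), DTree2.ins s(a, g) true R = insert s(a, g) R := fun R => by simp [DTree2.ins]
  have i0 : ∀ R : Finset (Sym2 V), DTree2.ins s(a, g) false R = R := fun R => by simp [DTree2.ins]
  have hopen : PrW (D.erase s(a, g)) p {R : Finset (Sym2 V) | DTree2.ins s(a, g) true R ∈ {K : Finset (Sym2 V) | b ∈ cl K a ∧ c ∉ cl K a}}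
      = PrW (D.erase s(a, g)) p {K : Finset (Sym2 V) | b ∈ cl K g ∧ c ∉ cl K g} := by
    refine PrW_congr_set _ p fun L hL => ?_
    have hLa := pendant_isolated_of_subset D a g hD hL
    simp only [Set.mem_setOf_eq, i1, pendant_apex_iff hag hLa hba, pendant_apex_iff hag hLa hca]
  have hclosed : PrW (D.erase s(a, g)) p {R : Finset (Sym2 V) | DTree2.ins s(a, g) false R ∈ {K : Finset (Sym2 V) | b ∈ cl K a ∧ c ∉ cl K a}} = 0 := by
    refine PrW_eq_zero_of_forall_not_mem _ p fun L hL hmem => ?_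
    have hLa := pendant_isolated_of_subset D a g hD hL
    simp only [Set.mem_setOf_eq, i0] at hmem
    exact pendant_not_mem_cl hLa hba hmem.1
  rw [DTree2.PrW_split D p he, Fintype.sum_bool]
  simp only [DTree2.wt1, if_true, Bool.false_eq_true, if_false]
  rw [hopen, hclosed]
  ring

/-- **Pendant lemma, cell `ac|b`.**  If the apex `a` meets exactly one edge `s(a,g)` of `D` (`a ≠ g`, `b, c ≠ a`), the `ac|b`-cell of
`(a; b, c)` on `D` is obtained from the cells of `(g; b, c)` on `D.erase s(a,g)` by pendant scaling with `z = p s(a,g)`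
(the cell map of `conjF_c_pendant`). [folklore] -/
theorem pendant_cell_ac (p : Sym2 V → ℝ) (D : Finset (Sym2 V)) (a g b c : V) (hag : a ≠ g) (hba : b ≠ a) (hca : c ≠ a)
    (he : s(a, g) ∈ D) (hD : ∀ f ∈ D, a ∈ f → f = s(a, g)) :
    PrW D p {K : Finset (Sym2 V) | c ∈ cl K a ∧ b ∉ cl K a}
      = p s(a, g) * PrW (D.erase s(a, g)) p {K : Finset (Sym2 V) | c ∈ cl K g ∧ b ∉ cl K g} := by
  have i1 : ∀ R : Finset (Sym2 V), DTree2.ins s(a, g) true R = insert s(a, g) R := fun R => by simp [DTree2.ins]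
  have i0 : ∀ R : Finset (Sym2 V), DTree2.ins s(a, g) false R = R := fun R => by simp [DTree2.ins]
  have hopen : PrW (D.erase s(a, g)) p {R : Finset (Sym2 V) | DTree2.ins s(a, g) true R ∈ {K : Finset (Sym2 V) | c ∈ cl K a ∧ b ∉ cl K a}}
      = PrW (D.erase s(a, g)) p {K : Finset (Sym2 V) | c ∈ cl K g ∧ b ∉ cl K g} := by
    refine PrW_congr_set _ p fun L hL => ?_
    have hLa := pendant_isolated_of_subset D a g hD hL
    simp only [Set.mem_setOf_eq, i1, pendant_apex_iff hag hLa hba, pendant_apex_iff hag hLa hca]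
  have hclosed : PrW (D.erase s(a, g)) p {R : Finset (Sym2 V) | DTree2.ins s(a, g) false R ∈ {K : Finset (Sym2 V) | c ∈ cl K a ∧ b ∉ cl K a}} = 0 := by
    refine PrW_eq_zero_of_forall_not_mem _ p fun L hL hmem => ?_
    have hLa := pendant_isolated_of_subset D a g hD hL
    simp only [Set.mem_setOf_eq, i0] at hmem
    exact pendant_not_mem_cl hLa hca hmem.1
  rw [DTree2.PrW_split D p he, Fintype.sum_bool]
  simp only [DTree2.wt1, if_true, Bool.false_eq_true, if_false]
  rw [hopen, hclosed]
  ring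

/-- **Pendant lemma, cell `a|bc`.**  If the apex `a` meets exactly one edge `s(a,g)` of `D` (`a ≠ g`, `b, c ≠ a`), the `a|bc`-cell of
`(a; b, c)` on `D` is obtained from the cells of `(g; b, c)` on `D.erase s(a,g)` by pendant scaling with `z = p s(a,g)`
(the cell map of `conjF_c_pendant`). [folklore] -/
theorem pendant_cell_bc (p : Sym2 V → ℝ) (D : Finset (Sym2 V)) (a g b c : V) (hag : a ≠ g) (hba : b ≠ a) (hca : c ≠ a)
    (he : s(a, g) ∈ D) (hD : ∀ f ∈ D, a ∈ f → f = s(a, g)) :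
    PrW D p {K : Finset (Sym2 V) | b ∉ cl K a ∧ c ∉ cl K a ∧ c ∈ cl K b}
      = p s(a, g) * PrW (D.erase s(a, g)) p {K : Finset (Sym2 V) | b ∉ cl K g ∧ c ∉ cl K g ∧ c ∈ cl K b} + (1 - p s(a, g)) * PrW (D.erase s(a, g)) p {K : Finset (Sym2 V) | c ∈ cl K b} := by
  have i1 : ∀ R : Finset (Sym2 V), DTree2.ins s(a, g) true R = insert s(a, g) R := fun R => by simp [DTree2.ins]
  have i0 : ∀ R : Finset (Sym2 V), DTree2.ins s(a, g) false R = R := fun R => by simp [DTree2.ins]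
  have hopen : PrW (D.erase s(a, g)) p {R : Finset (Sym2 V) | DTree2.ins s(a, g) true R ∈ {K : Finset (Sym2 V) | b ∉ cl K a ∧ c ∉ cl K a ∧ c ∈ cl K b}}
      = PrW (D.erase s(a, g)) p {K : Finset (Sym2 V) | b ∉ cl K g ∧ c ∉ cl K g ∧ c ∈ cl K b} := by
    refine PrW_congr_set _ p fun L hL => ?_
    have hLa := pendant_isolated_of_subset D a g hD hL
    simp only [Set.mem_setOf_eq, i1, pendant_apex_iff hag hLa hba, pendant_apex_iff hag hLa hca, pendant_bc_iff hag hLa hba hca]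
  have hclosed : PrW (D.erase s(a, g)) p {R : Finset (Sym2 V) | DTree2.ins s(a, g) false R ∈ {K : Finset (Sym2 V) | b ∉ cl K a ∧ c ∉ cl K a ∧ c ∈ cl K b}}
      = PrW (D.erase s(a, g)) p {K : Finset (Sym2 V) | c ∈ cl K b} := by
    refine PrW_congr_set _ p fun L hL => ?_
    have hLa := pendant_isolated_of_subset D a g hD hL
    simp only [Set.mem_setOf_eq, i0, pendant_not_mem_cl hLa hba, pendant_not_mem_cl hLa hca, not_false_eq_true, true_and]
  rw [DTree2.PrW_split D p he, Fintype.sum_bool]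
  simp only [DTree2.wt1, if_true, Bool.false_eq_true, if_false]
  rw [hopen, hclosed]

/-- **Pendant lemma, cell `abc`.**  If the apex `a` meets exactly one edge `s(a,g)` of `D` (`a ≠ g`, `b, c ≠ a`), the `abc`-cell of
`(a; b, c)` on `D` is obtained from the cells of `(g; b, c)` on `D.erase s(a,g)` by pendant scaling with `z = p s(a,g)`
(the cell map of `conjF_c_pendant`). [folklore] -/
theorem pendant_cell_three (p : Sym2 V → ℝ) (D : Finset (Sym2 V)) (a g b c : V) (hag : a ≠ g) (hba : b ≠ a) (hca : c ≠ a)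
    (he : s(a, g) ∈ D) (hD : ∀ f ∈ D, a ∈ f → f = s(a, g)) :
    PrW D p {K : Finset (Sym2 V) | b ∈ cl K a ∧ c ∈ cl K a}
      = p s(a, g) * PrW (D.erase s(a, g)) p {K : Finset (Sym2 V) | b ∈ cl K g ∧ c ∈ cl K g} := by
  have i1 : ∀ R : Finset (Sym2 V), DTree2.ins s(a, g) true R = insert s(a, g) R := fun R => by simp [DTree2.ins]
  have i0 : ∀ R : Finset (Sym2 V), DTree2.ins s(a, g) false R = R := fun R => by simp [DTree2.ins]
  have hopen : PrW (D.erase s(a, g)) p {R : Finset (Sym2 V) | DTree2.ins s(a, g) true R ∈ {K : Finset (Sym2 V) | b ∈ cl K a ∧ c ∈ cl K a}}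
      = PrW (D.erase s(a, g)) p {K : Finset (Sym2 V) | b ∈ cl K g ∧ c ∈ cl K g} := by
    refine PrW_congr_set _ p fun L hL => ?_
    have hLa := pendant_isolated_of_subset D a g hD hL
    simp only [Set.mem_setOf_eq, i1, pendant_apex_iff hag hLa hba, pendant_apex_iff hag hLa hca]
  have hclosed : PrW (D.erase s(a, g)) p {R : Finset (Sym2 V) | DTree2.ins s(a, g) false R ∈ {K : Finset (Sym2 V) | b ∈ cl K a ∧ c ∈ cl K a}} = 0 := by
    refine PrW_eq_zero_of_forall_not_mem _ p fun L hL hmem => ?_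
    have hLa := pendant_isolated_of_subset D a g hD hL
    simp only [Set.mem_setOf_eq, i0] at hmem
    exact pendant_not_mem_cl hLa hba hmem.1
  rw [DTree2.PrW_split D p he, Fintype.sum_bool]
  simp only [DTree2.wt1, if_true, Bool.false_eq_true, if_false]
  rw [hopen, hclosed]
  ring

/-- `P_{D'}(b ↮ c) = u0 + uab + uac` for the cells of `(g; b, c)` (the three cells with `b ↮ c`). [folklore] -/
theorem pendant_split_bc (p : Sym2 V → ℝ) (D' : Finset (Sym2 V)) (g b c : V) :
    PrW D' p {K : Finset (Sym2 V) | c ∉ cl K b}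
      = PrW D' p {K : Finset (Sym2 V) | b ∉ cl K g ∧ c ∉ cl K g ∧ c ∉ cl K b} + PrW D' p {K : Finset (Sym2 V) | b ∈ cl K g ∧ c ∉ cl K g} + PrW D' p {K : Finset (Sym2 V) | c ∈ cl K g ∧ b ∉ cl K g} := by
  simp only [PrW_eq_sum_ind, ← Finset.sum_add_distrib]
  refine Finset.sum_congr rfl fun S _ => ?_
  rw [← mul_add, ← mul_add]
  congr 1
  rcases cl_cell_cases S g b c with ⟨h1, h2, h3⟩ | ⟨h1, h2, h3⟩ | ⟨h1, h2, h3⟩ | ⟨h1, h2, h3⟩ | ⟨h1, h2, h3⟩ <;>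
  simp [ind, Set.mem_setOf_eq, h1, h2, h3]

/-- `P_{D'}(b ↔ c) = ubc + u3` for the cells of `(g; b, c)`. [folklore] -/
theorem pendant_split_bc' (p : Sym2 V → ℝ) (D' : Finset (Sym2 V)) (g b c : V) :
    PrW D' p {K : Finset (Sym2 V) | c ∈ cl K b}
      = PrW D' p {K : Finset (Sym2 V) | b ∉ cl K g ∧ c ∉ cl K g ∧ c ∈ cl K b} + PrW D' p {K : Finset (Sym2 V) | b ∈ cl K g ∧ c ∈ cl K g} := by
  simp only [PrW_eq_sum_ind, ← Finset.sum_add_distrib]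
  refine Finset.sum_congr rfl fun S _ => ?_
  rw [← mul_add]
  congr 1
  rcases cl_cell_cases S g b c with ⟨h1, h2, h3⟩ | ⟨h1, h2, h3⟩ | ⟨h1, h2, h3⟩ | ⟨h1, h2, h3⟩ | ⟨h1, h2, h3⟩ <;>
  simp [ind, Set.mem_setOf_eq, h1, h2, h3]

end APL

end Summit.CriticalPhenomena.PercolationContinuityZ3.Theorems
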